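/-
# PROBE 24 (pub-hlocus ivhs-2, ENGINE B gen 56) — THE WINDOW OF THE UNIT-COLUMN RANK DROP, ALL BANDS

certified instances and evidence bearing on the general Hodge conjecture; no claim.

For a prime `p > c` anchor 304 ((DROP) `rank_charP_add_eq_rank_charZero_add`) writes the characteristic-`p` rank deficit of anchor 229's
multiplicity matrix of `×q^c` on `K[x₁,…,x_k]/(xᵢ^{e+2})` at level `j`, for EVERY `k`, as a difference of two label sums of Wilson terms.
Anchor 320 ((LOC)/(ENDS)) located the deficit on the FIRST BAND `k + c = 2p + r`, `r < 2c`: zero outside the window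
`(e+1)(p − c) ≤ j ≤ (e+1)(p − c + r)`, exactly one at its two ends.  Here the window is established for EVERY `k` (every band), straight from
(DROP): with `S = #{i : μ i ≠ 0}` and `Σμ ≤ e·S` (anchor 320's (UB)) every label's Wilson block at a level `j < (e+1)(p − c)` has `T + c < p`,
so both correction terms vanish ((P0), (Z0)); at `j = (e+1)(p − c)` only the zero label survives, with the single binomial `C(k, 0) = 1`
((P1)), as soon as `2p ≤ k + c`; the upper half follows from anchor 312's level symmetry `j ↔ (k − c)(e+1) − j` ((SYM-K)
`rank_levels_symm_field`), and beyond `(k − c)(e+1)` the matrix has no columns.  Hence, for a prime `p`, `c < p`, ANY `k`, `e`, a field `K` of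
characteristic `p` and a field `K₀` of characteristic `0`:
  (WIN-LOW)   `rank_charP_eq_rank_charZero_of_lt`        — `j < (e+1)(p − c)`  ⟹  `rank_K = rank_{K₀}`;
  (WIN-HIGH)  `rank_charP_eq_rank_charZero_of_gt`        — `(e+1)(k − p) < j`  ⟹  `rank_K = rank_{K₀}`;
  (LOW-END)   `rank_charP_add_one_eq_rank_charZero_of_eq_low`  — `1 ≤ c`, `2p ≤ k + c`, `j = (e+1)(p − c)`  ⟹  `rank_K + 1 = rank_{K₀}`;
  (HIGH-END)  `rank_charP_add_one_eq_rank_charZero_of_eq_high` — `1 ≤ c`, `2p ≤ k + c`, `j = (e+1)(k − p)`  ⟹  `rank_K + 1 = rank_{K₀}`;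
  (WIN-OUT) / (WIN-ENDS) `rank_charP_eq_rank_charZero_of_out_of_window` / `rank_charP_add_one_eq_rank_charZero_of_window_end` — HEADLINES:
  THE DROP IS CONFINED TO THE WINDOW `(e+1)(p − c) ≤ j ≤ (e+1)(k − p)` AND IS EXACTLY ONE AT BOTH ITS ENDS (`c ≥ 1`), FOR EVERY `k ≥ 2p − c`
  (no hypothesis `r < 2c`; on the first band `(e+1)(k − p) = (e+1)(p − c + r)` and these are anchor 320's (LOC)/(ENDS); for `k + c < 2p` the
  window is empty and (WIN-LOW)/(WIN-HIGH) cover every level, consistent with anchor 296's criterion).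
Own numerics FIRST (`probe24/window_numerics.py` → `window_numerics.out`): anchor 304's closed form on 1 172 cells (p ≤ 7, 1 ≤ c < p, k ≤ 4p + 1,
e ≤ 3; 39 954 levels): zero below / above the window, one at both ends, 0 bad — and, informative only, a POSITIVE drop at every interior window
level (not proved here); ACTUAL ranks of the literal matrices (own GF(p)/ℚ elimination; p ≤ 5, 1 ≤ c < p, 2p − c ≤ k ≤ 3p + c, e ≤ 2,
size-guarded) at the two ends and their outer neighbours: 262 level checks, 98 of them beyond the first band (`k ≥ 2p + c`), 0 bad.
EVIDENCE CLASS: kernel theorems about the census matrices; no census number changes; nothing here asserts anything about the Hodge conjecture.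

Imports: anchor 320 `…Theorems.HodgeLocusCensusUnitColumnRankDropBandProfile` ((UB) `sum_label_le_mul_card_filter`; hence 307 and 304 (DROP))
and anchor 312 `…Theorems.HodgeLocusCensusUnitColumnRankLevelSymmetry` ((SYM-K) `rank_levels_symm_field`).
-/
import Summits.HodgeConjecture.HodgeConjecture.Theorems.HodgeLocusCensusUnitColumnRankDropBandProfile
import Summits.HodgeConjecture.HodgeConjecture.Theorems.HodgeLocusCensusUnitColumnRankLevelSymmetry

set_option linter.dupNamespace false
set_option autoImplicit false

namespace Summit.HodgeConjecture.HodgeConjecture.HodgeLocus.Census.UnitColumnRankDropWindow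

open Summit.HodgeConjecture.HodgeConjecture.HodgeLocus.Census.ModelNonJumpC1All (colR)
open Summit.HodgeConjecture.HodgeConjecture.HodgeLocus.Census.UnitColumnRankDrop (rank_charP_add_eq_rank_charZero_add)
open Summit.HodgeConjecture.HodgeConjecture.HodgeLocus.Census.UnitColumnRankDropBandProfile (sum_label_le_mul_card_filter)
open Summit.HodgeConjecture.HodgeConjecture.HodgeLocus.Census.UnitColumnRankLevelSymmetry (rank_levels_symm_field)

/-! ## §1 Per-label vanishing of anchor 304's correction terms below the window, and the zero label at the lower end -/

/-- (P0) a feasible label `μ` with `j + Σμ < (e+1)(p − c + S)` (`S = #{i : μ i ≠ 0}`) carries no characteristic-`p` correction term of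
anchor 304's (DROP): its block has `t = (j + Σμ)/(e+1) − S`, so `T + c ≤ t + c < p` and the range `(T + c)/p` is empty. -/
theorem corrP_eq_zero_of_lt (p k e c j : ℕ) (μ : Fin k → Fin (e + 1))
    (h : j + ∑ i, (μ i : ℕ) < (e + 1) * (p - c + (Finset.univ.filter (fun l => (μ l : ℕ) ≠ 0)).card)) :
        (if (e + 1) ∣ (j + ∑ i, (μ i : ℕ)) ∧ (e + 1) * (Finset.univ.filter (fun l => (μ l : ℕ) ≠ 0)).card ≤ j + ∑ i, (μ i : ℕ) then
          (if k - (Finset.univ.filter (fun l => (μ l : ℕ) ≠ 0)).card < ((j + ∑ i, (μ i : ℕ)) / (e + 1) - (Finset.univ.filter (fun l => (μ l : ℕ) ≠ 0)).card) + c then 0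
           else ∑ b ∈ Finset.range ((min ((j + ∑ i, (μ i : ℕ)) / (e + 1) - (Finset.univ.filter (fun l => (μ l : ℕ) ≠ 0)).card)
               (k - (Finset.univ.filter (fun l => (μ l : ℕ) ≠ 0)).card -
                 ((j + ∑ i, (μ i : ℕ)) / (e + 1) - (Finset.univ.filter (fun l => (μ l : ℕ) ≠ 0)).card) - c) + c) / p),
             (k - (Finset.univ.filter (fun l => (μ l : ℕ) ≠ 0)).card).choose (min ((j + ∑ i, (μ i : ℕ)) / (e + 1) - (Finset.univ.filter (fun l => (μ l : ℕ) ≠ 0)).card)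
               (k - (Finset.univ.filter (fun l => (μ l : ℕ) ≠ 0)).card -
                 ((j + ∑ i, (μ i : ℕ)) / (e + 1) - (Finset.univ.filter (fun l => (μ l : ℕ) ≠ 0)).card) - c) + c - (b + 1) * p))
         else 0) = 0 := by
  have hq : (j + ∑ i, (μ i : ℕ)) / (e + 1) < p - c + (Finset.univ.filter (fun l => (μ l : ℕ) ≠ 0)).card := by
    rw [Nat.div_lt_iff_lt_mul (Nat.succ_pos e), Nat.mul_comm]; exact h
  split_ifs with hF hlt
  · rfl
  · have hSq : (Finset.univ.filter (fun l => (μ l : ℕ) ≠ 0)).card ≤ (j + ∑ i, (μ i : ℕ)) / (e + 1) := by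
      rw [Nat.le_div_iff_mul_le (Nat.succ_pos e), Nat.mul_comm]; exact hF.2
    rw [Nat.div_eq_of_lt (by rw [Nat.min_def]; split_ifs <;> omega), Finset.range_zero, Finset.sum_empty]
  · rfl

/-- (Z0) a feasible label `μ` with `j + Σμ < (e+1)(p + S)` carries no characteristic-`0` correction term of anchor 304's (DROP): `T ≤ t < p`,
the range `T/p` is empty (every label at a level `j < (e+1)(p − c)`, or `j = (e+1)(p − c)` with `c ≥ 1`, qualifies by `Σμ ≤ e·S`). -/
theorem corr0_eq_zero_of_lt (p k e c j : ℕ) (μ : Fin k → Fin (e + 1))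
    (h : j + ∑ i, (μ i : ℕ) < (e + 1) * (p + (Finset.univ.filter (fun l => (μ l : ℕ) ≠ 0)).card)) :
        (if (e + 1) ∣ (j + ∑ i, (μ i : ℕ)) ∧ (e + 1) * (Finset.univ.filter (fun l => (μ l : ℕ) ≠ 0)).card ≤ j + ∑ i, (μ i : ℕ) then
          (if k - (Finset.univ.filter (fun l => (μ l : ℕ) ≠ 0)).card < ((j + ∑ i, (μ i : ℕ)) / (e + 1) - (Finset.univ.filter (fun l => (μ l : ℕ) ≠ 0)).card) + c then 0
           else ∑ b ∈ Finset.range ((min ((j + ∑ i, (μ i : ℕ)) / (e + 1) - (Finset.univ.filter (fun l => (μ l : ℕ) ≠ 0)).card)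
               (k - (Finset.univ.filter (fun l => (μ l : ℕ) ≠ 0)).card -
                 ((j + ∑ i, (μ i : ℕ)) / (e + 1) - (Finset.univ.filter (fun l => (μ l : ℕ) ≠ 0)).card) - c)) / p),
             (k - (Finset.univ.filter (fun l => (μ l : ℕ) ≠ 0)).card).choose (min ((j + ∑ i, (μ i : ℕ)) / (e + 1) - (Finset.univ.filter (fun l => (μ l : ℕ) ≠ 0)).card)
               (k - (Finset.univ.filter (fun l => (μ l : ℕ) ≠ 0)).card -
                 ((j + ∑ i, (μ i : ℕ)) / (e + 1) - (Finset.univ.filter (fun l => (μ l : ℕ) ≠ 0)).card) - c) - (b + 1) * p))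
         else 0) = 0 := by
  have hq : (j + ∑ i, (μ i : ℕ)) / (e + 1) < p + (Finset.univ.filter (fun l => (μ l : ℕ) ≠ 0)).card := by
    rw [Nat.div_lt_iff_lt_mul (Nat.succ_pos e), Nat.mul_comm]; exact h
  split_ifs with hF hlt
  · rfl
  · have hSq : (Finset.univ.filter (fun l => (μ l : ℕ) ≠ 0)).card ≤ (j + ∑ i, (μ i : ℕ)) / (e + 1) := by
      rw [Nat.le_div_iff_mul_le (Nat.succ_pos e), Nat.mul_comm]; exact hF.2
    rw [Nat.div_eq_of_lt (by rw [Nat.min_def]; split_ifs <;> omega), Finset.range_zero, Finset.sum_empty]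
  · rfl

/-- (P1) at the lower end `j = (e+1)(p − c)`, with `c < p` and `2p ≤ k + c`, the ZERO label carries the characteristic-`p` correction term `1`:
its block is `c!·W_{p−c,p}` on all `k` coordinates, `T = min (p − c, k − p) = p − c`, `T + c = p`, one surviving binomial `C(k, 0) = 1`
(anchor 304's (Z1) is the case `k + c = 2p`; for `c = 0` the term is cancelled by the characteristic-`0` one). -/
theorem corrP_zero_label_eq_one (p k e c j : ℕ) (μ : Fin k → Fin (e + 1)) (hμ : μ = fun _ => 0) (hcp : c < p) (hk : 2 * p ≤ k + c)
    (hj : j = (e + 1) * (p - c)) :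
        (if (e + 1) ∣ (j + ∑ i, (μ i : ℕ)) ∧ (e + 1) * (Finset.univ.filter (fun l => (μ l : ℕ) ≠ 0)).card ≤ j + ∑ i, (μ i : ℕ) then
          (if k - (Finset.univ.filter (fun l => (μ l : ℕ) ≠ 0)).card < ((j + ∑ i, (μ i : ℕ)) / (e + 1) - (Finset.univ.filter (fun l => (μ l : ℕ) ≠ 0)).card) + c then 0
           else ∑ b ∈ Finset.range ((min ((j + ∑ i, (μ i : ℕ)) / (e + 1) - (Finset.univ.filter (fun l => (μ l : ℕ) ≠ 0)).card)
               (k - (Finset.univ.filter (fun l => (μ l : ℕ) ≠ 0)).card -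
                 ((j + ∑ i, (μ i : ℕ)) / (e + 1) - (Finset.univ.filter (fun l => (μ l : ℕ) ≠ 0)).card) - c) + c) / p),
             (k - (Finset.univ.filter (fun l => (μ l : ℕ) ≠ 0)).card).choose (min ((j + ∑ i, (μ i : ℕ)) / (e + 1) - (Finset.univ.filter (fun l => (μ l : ℕ) ≠ 0)).card)
               (k - (Finset.univ.filter (fun l => (μ l : ℕ) ≠ 0)).card -
                 ((j + ∑ i, (μ i : ℕ)) / (e + 1) - (Finset.univ.filter (fun l => (μ l : ℕ) ≠ 0)).card) - c) + c - (b + 1) * p))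
         else 0) = 1 := by
  subst hμ
  have hs : (Finset.univ.filter (fun l : Fin k => (((fun _ => (0 : Fin (e + 1))) l : Fin (e + 1)) : ℕ) ≠ 0)).card = 0 := by simp
  have hsum : (∑ i : Fin k, (((fun _ => (0 : Fin (e + 1))) i : Fin (e + 1)) : ℕ)) = 0 := by simp
  simp only [hs, hsum, add_zero, mul_zero, Nat.sub_zero]
  subst hj
  rw [if_pos ⟨Dvd.intro _ rfl, Nat.zero_le _⟩, Nat.mul_div_cancel_left (p - c) (Nat.succ_pos e), if_neg (by omega),
    show min (p - c) (k - (p - c) - c) = p - c by rw [Nat.min_def]; split_ifs <;> omega, Nat.sub_add_cancel hcp.le,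
    Nat.div_self (by omega : 0 < p), Finset.sum_range_one, show p - (0 + 1) * p = 0 by simp, Nat.choose_zero_right]

/-! ## §2 The lower half: no drop below `(e+1)(p − c)`, a drop of exactly one at `(e+1)(p − c)` — every `k` -/

/-- **(WIN-LOW) NO DROP BELOW THE WINDOW, EVERY `k`.** For a prime `p`, `c < p`, any `k`, `e` and `j < (e+1)(p − c)`: anchor 229's multiplicity
matrix of `×q^c` at level `j` (VERBATIM) has the same rank over a field `K` of characteristic `p` as over a field `K₀` of characteristic `0`
((DROP) with (P0), (Z0) and anchor 320's (UB) `Σμ ≤ e·S`). -/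
theorem rank_charP_eq_rank_charZero_of_lt (K K₀ : Type*) [Field K] [Field K₀] (p : ℕ) [CharP K p] [CharZero K₀] (hp : p.Prime)
    (k e c j : ℕ) (hcp : c < p) (hj : j < (e + 1) * (p - c)) :
    (Matrix.of fun (v : {v : Fin k → Fin (e + 2) // (∑ i, (v i : ℕ)) + j = k * (e + 1)})
        (m : {m : Fin k → Fin (e + 2) // (∑ i, (m i : ℕ)) + (j + c * (e + 1)) = k * (e + 1)}) =>
      ((((List.flatMap (colR (e + 3)))^[c] [List.ofFn (fun i => (m.1 i : ℕ))]).count (List.ofFn (fun i => (v.1 i : ℕ))) : ℕ) : K)).rank =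
    (Matrix.of fun (v : {v : Fin k → Fin (e + 2) // (∑ i, (v i : ℕ)) + j = k * (e + 1)})
        (m : {m : Fin k → Fin (e + 2) // (∑ i, (m i : ℕ)) + (j + c * (e + 1)) = k * (e + 1)}) =>
      ((((List.flatMap (colR (e + 3)))^[c] [List.ofFn (fun i => (m.1 i : ℕ))]).count (List.ofFn (fun i => (v.1 i : ℕ))) : ℕ) : K₀)).rank := by
  have h := rank_charP_add_eq_rank_charZero_add K K₀ p hp k e c j hcp
  have hP : ∀ μ ∈ (Finset.univ : Finset (Fin k → Fin (e + 1))),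
        (if (e + 1) ∣ (j + ∑ i, (μ i : ℕ)) ∧ (e + 1) * (Finset.univ.filter (fun l => (μ l : ℕ) ≠ 0)).card ≤ j + ∑ i, (μ i : ℕ) then
          (if k - (Finset.univ.filter (fun l => (μ l : ℕ) ≠ 0)).card < ((j + ∑ i, (μ i : ℕ)) / (e + 1) - (Finset.univ.filter (fun l => (μ l : ℕ) ≠ 0)).card) + c then 0
           else ∑ b ∈ Finset.range ((min ((j + ∑ i, (μ i : ℕ)) / (e + 1) - (Finset.univ.filter (fun l => (μ l : ℕ) ≠ 0)).card)
               (k - (Finset.univ.filter (fun l => (μ l : ℕ) ≠ 0)).card -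
                 ((j + ∑ i, (μ i : ℕ)) / (e + 1) - (Finset.univ.filter (fun l => (μ l : ℕ) ≠ 0)).card) - c) + c) / p),
             (k - (Finset.univ.filter (fun l => (μ l : ℕ) ≠ 0)).card).choose (min ((j + ∑ i, (μ i : ℕ)) / (e + 1) - (Finset.univ.filter (fun l => (μ l : ℕ) ≠ 0)).card)
               (k - (Finset.univ.filter (fun l => (μ l : ℕ) ≠ 0)).card -
                 ((j + ∑ i, (μ i : ℕ)) / (e + 1) - (Finset.univ.filter (fun l => (μ l : ℕ) ≠ 0)).card) - c) + c - (b + 1) * p))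
         else 0) = 0 := fun μ _ => corrP_eq_zero_of_lt p k e c j μ (by
    have hub := sum_label_le_mul_card_filter k e μ
    have e1 : (e + 1) * (p - c + (Finset.univ.filter (fun l => (μ l : ℕ) ≠ 0)).card) =
        (e + 1) * (p - c) + e * (Finset.univ.filter (fun l => (μ l : ℕ) ≠ 0)).card + (Finset.univ.filter (fun l => (μ l : ℕ) ≠ 0)).card := by
      ring
    omega)
  have hZ : ∀ μ ∈ (Finset.univ : Finset (Fin k → Fin (e + 1))),
        (if (e + 1) ∣ (j + ∑ i, (μ i : ℕ)) ∧ (e + 1) * (Finset.univ.filter (fun l => (μ l : ℕ) ≠ 0)).card ≤ j + ∑ i, (μ i : ℕ) then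
          (if k - (Finset.univ.filter (fun l => (μ l : ℕ) ≠ 0)).card < ((j + ∑ i, (μ i : ℕ)) / (e + 1) - (Finset.univ.filter (fun l => (μ l : ℕ) ≠ 0)).card) + c then 0
           else ∑ b ∈ Finset.range ((min ((j + ∑ i, (μ i : ℕ)) / (e + 1) - (Finset.univ.filter (fun l => (μ l : ℕ) ≠ 0)).card)
               (k - (Finset.univ.filter (fun l => (μ l : ℕ) ≠ 0)).card -
                 ((j + ∑ i, (μ i : ℕ)) / (e + 1) - (Finset.univ.filter (fun l => (μ l : ℕ) ≠ 0)).card) - c)) / p),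
             (k - (Finset.univ.filter (fun l => (μ l : ℕ) ≠ 0)).card).choose (min ((j + ∑ i, (μ i : ℕ)) / (e + 1) - (Finset.univ.filter (fun l => (μ l : ℕ) ≠ 0)).card)
               (k - (Finset.univ.filter (fun l => (μ l : ℕ) ≠ 0)).card -
                 ((j + ∑ i, (μ i : ℕ)) / (e + 1) - (Finset.univ.filter (fun l => (μ l : ℕ) ≠ 0)).card) - c) - (b + 1) * p))
         else 0) = 0 := fun μ _ => corr0_eq_zero_of_lt p k e c j μ (by
    have hub := sum_label_le_mul_card_filter k e μ
    have e1 : (e + 1) * (p + (Finset.univ.filter (fun l => (μ l : ℕ) ≠ 0)).card) =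
        (e + 1) * p + e * (Finset.univ.filter (fun l => (μ l : ℕ) ≠ 0)).card + (Finset.univ.filter (fun l => (μ l : ℕ) ≠ 0)).card := by
      ring
    have e2 : (e + 1) * (p - c) ≤ (e + 1) * p := Nat.mul_le_mul_left (e + 1) (Nat.sub_le p c)
    omega)
  rw [Finset.sum_eq_zero hP, Finset.sum_eq_zero hZ, add_zero, add_zero] at h
  exact h

/-- **(LOW-END) A DROP OF EXACTLY ONE AT THE LOWER END, EVERY `k ≥ 2p − c`.** For a prime `p`, `1 ≤ c < p`, `2p ≤ k + c` and `j = (e+1)(p − c)`: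
`rank_K + 1 = rank_{K₀}` for anchor 229's matrix at level `j` ((DROP) with (P0) off the zero label, (P1) on it, (Z0) everywhere). -/
theorem rank_charP_add_one_eq_rank_charZero_of_eq_low (K K₀ : Type*) [Field K] [Field K₀] (p : ℕ) [CharP K p] [CharZero K₀]
    (hp : p.Prime) (k e c j : ℕ) (hc : 0 < c) (hcp : c < p) (hk : 2 * p ≤ k + c) (hj : j = (e + 1) * (p - c)) :
    (Matrix.of fun (v : {v : Fin k → Fin (e + 2) // (∑ i, (v i : ℕ)) + j = k * (e + 1)})
        (m : {m : Fin k → Fin (e + 2) // (∑ i, (m i : ℕ)) + (j + c * (e + 1)) = k * (e + 1)}) =>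
      ((((List.flatMap (colR (e + 3)))^[c] [List.ofFn (fun i => (m.1 i : ℕ))]).count (List.ofFn (fun i => (v.1 i : ℕ))) : ℕ) : K)).rank + 1 =
    (Matrix.of fun (v : {v : Fin k → Fin (e + 2) // (∑ i, (v i : ℕ)) + j = k * (e + 1)})
        (m : {m : Fin k → Fin (e + 2) // (∑ i, (m i : ℕ)) + (j + c * (e + 1)) = k * (e + 1)}) =>
      ((((List.flatMap (colR (e + 3)))^[c] [List.ofFn (fun i => (m.1 i : ℕ))]).count (List.ofFn (fun i => (v.1 i : ℕ))) : ℕ) : K₀)).rank := by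
  have h := rank_charP_add_eq_rank_charZero_add K K₀ p hp k e c j hcp
  have hZ : ∀ μ ∈ (Finset.univ : Finset (Fin k → Fin (e + 1))),
        (if (e + 1) ∣ (j + ∑ i, (μ i : ℕ)) ∧ (e + 1) * (Finset.univ.filter (fun l => (μ l : ℕ) ≠ 0)).card ≤ j + ∑ i, (μ i : ℕ) then
          (if k - (Finset.univ.filter (fun l => (μ l : ℕ) ≠ 0)).card < ((j + ∑ i, (μ i : ℕ)) / (e + 1) - (Finset.univ.filter (fun l => (μ l : ℕ) ≠ 0)).card) + c then 0
           else ∑ b ∈ Finset.range ((min ((j + ∑ i, (μ i : ℕ)) / (e + 1) - (Finset.univ.filter (fun l => (μ l : ℕ) ≠ 0)).card)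
               (k - (Finset.univ.filter (fun l => (μ l : ℕ) ≠ 0)).card -
                 ((j + ∑ i, (μ i : ℕ)) / (e + 1) - (Finset.univ.filter (fun l => (μ l : ℕ) ≠ 0)).card) - c)) / p),
             (k - (Finset.univ.filter (fun l => (μ l : ℕ) ≠ 0)).card).choose (min ((j + ∑ i, (μ i : ℕ)) / (e + 1) - (Finset.univ.filter (fun l => (μ l : ℕ) ≠ 0)).card)
               (k - (Finset.univ.filter (fun l => (μ l : ℕ) ≠ 0)).card -
                 ((j + ∑ i, (μ i : ℕ)) / (e + 1) - (Finset.univ.filter (fun l => (μ l : ℕ) ≠ 0)).card) - c) - (b + 1) * p))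
         else 0) = 0 := fun μ _ => corr0_eq_zero_of_lt p k e c j μ (by
    have hub := sum_label_le_mul_card_filter k e μ
    have e1 : (e + 1) * (p + (Finset.univ.filter (fun l => (μ l : ℕ) ≠ 0)).card) =
        (e + 1) * p + e * (Finset.univ.filter (fun l => (μ l : ℕ) ≠ 0)).card + (Finset.univ.filter (fun l => (μ l : ℕ) ≠ 0)).card := by
      ring
    have e2 : (e + 1) * (p - c) + (e + 1) * c = (e + 1) * p := by rw [← Nat.mul_add]; congr 1; omega
    have e3 : c ≤ (e + 1) * c := Nat.le_mul_of_pos_left c (Nat.succ_pos e)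
    omega)
  rw [Finset.sum_eq_zero hZ, add_zero,
    Finset.sum_eq_single (fun _ => (0 : Fin (e + 1))) (fun μ _ hμ => corrP_eq_zero_of_lt p k e c j μ (by
      obtain ⟨l, hl⟩ := Function.ne_iff.mp hμ
      have hs1 : 1 ≤ (Finset.univ.filter (fun l => (μ l : ℕ) ≠ 0)).card :=
        Finset.card_pos.mpr ⟨l, Finset.mem_filter.mpr ⟨Finset.mem_univ _, fun h0 => hl (Fin.ext h0)⟩⟩
      have hub := sum_label_le_mul_card_filter k e μ
      have e1 : (e + 1) * (p - c + (Finset.univ.filter (fun l => (μ l : ℕ) ≠ 0)).card) =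
          (e + 1) * (p - c) + e * (Finset.univ.filter (fun l => (μ l : ℕ) ≠ 0)).card + (Finset.univ.filter (fun l => (μ l : ℕ) ≠ 0)).card := by
        ring
      omega))
      (fun h' => absurd (Finset.mem_univ _) h'),
    corrP_zero_label_eq_one p k e c j _ rfl hcp hk hj] at h
  exact h

/-! ## §3 The upper half by anchor 312's level symmetry, and the window theorems -/

/-- **(WIN-HIGH) NO DROP ABOVE THE WINDOW, EVERY `k`.** For a prime `p`, `c < p`, any `k`, `e` and `(e+1)(k − p) < j`: `rank_K = rank_{K₀}`
at level `j` — for `j ≤ (k − c)(e+1)` by (SYM-K) `rank_levels_symm_field` (both fields) and (WIN-LOW) at the mirror level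
`(k − c)(e+1) − j < (e+1)(p − c)`; for `j > (k − c)(e+1)` the matrix has no columns and both ranks vanish. -/
theorem rank_charP_eq_rank_charZero_of_gt (K K₀ : Type*) [Field K] [Field K₀] (p : ℕ) [CharP K p] [CharZero K₀] (hp : p.Prime)
    (k e c j : ℕ) (hcp : c < p) (hj : (e + 1) * (k - p) < j) :
    (Matrix.of fun (v : {v : Fin k → Fin (e + 2) // (∑ i, (v i : ℕ)) + j = k * (e + 1)})
        (m : {m : Fin k → Fin (e + 2) // (∑ i, (m i : ℕ)) + (j + c * (e + 1)) = k * (e + 1)}) =>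
      ((((List.flatMap (colR (e + 3)))^[c] [List.ofFn (fun i => (m.1 i : ℕ))]).count (List.ofFn (fun i => (v.1 i : ℕ))) : ℕ) : K)).rank =
    (Matrix.of fun (v : {v : Fin k → Fin (e + 2) // (∑ i, (v i : ℕ)) + j = k * (e + 1)})
        (m : {m : Fin k → Fin (e + 2) // (∑ i, (m i : ℕ)) + (j + c * (e + 1)) = k * (e + 1)}) =>
      ((((List.flatMap (colR (e + 3)))^[c] [List.ofFn (fun i => (m.1 i : ℕ))]).count (List.ofFn (fun i => (v.1 i : ℕ))) : ℕ) : K₀)).rank := by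
  rcases Nat.lt_or_ge ((k - c) * (e + 1)) j with hjc | hjc
  · have hX : (k - c) * (e + 1) = k * (e + 1) - c * (e + 1) := Nat.sub_mul k c (e + 1)
    haveI : IsEmpty {m : Fin k → Fin (e + 2) // (∑ i, (m i : ℕ)) + (j + c * (e + 1)) = k * (e + 1)} :=
      ⟨fun m => by have hm := m.2; omega⟩
    have hK := Matrix.rank_le_card_width
      (Matrix.of fun (v : {v : Fin k → Fin (e + 2) // (∑ i, (v i : ℕ)) + j = k * (e + 1)})
        (m : {m : Fin k → Fin (e + 2) // (∑ i, (m i : ℕ)) + (j + c * (e + 1)) = k * (e + 1)}) =>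
      ((((List.flatMap (colR (e + 3)))^[c] [List.ofFn (fun i => (m.1 i : ℕ))]).count (List.ofFn (fun i => (v.1 i : ℕ))) : ℕ) : K))
    have h0 := Matrix.rank_le_card_width
      (Matrix.of fun (v : {v : Fin k → Fin (e + 2) // (∑ i, (v i : ℕ)) + j = k * (e + 1)})
        (m : {m : Fin k → Fin (e + 2) // (∑ i, (m i : ℕ)) + (j + c * (e + 1)) = k * (e + 1)}) =>
      ((((List.flatMap (colR (e + 3)))^[c] [List.ofFn (fun i => (m.1 i : ℕ))]).count (List.ofFn (fun i => (v.1 i : ℕ))) : ℕ) : K₀))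
    rw [Fintype.card_eq_zero] at hK h0
    omega
  · obtain ⟨j', hjj⟩ : ∃ j', j + j' = (k - c) * (e + 1) := ⟨(k - c) * (e + 1) - j, by omega⟩
    rw [rank_levels_symm_field K k e c j j' hjj, rank_levels_symm_field K₀ k e c j j' hjj]
    apply rank_charP_eq_rank_charZero_of_lt K K₀ p hp k e c j' hcp
    rcases Nat.lt_or_ge k p with hkp | hkp
    · have h3 : (e + 1) * (k - c) + (e + 1) ≤ (e + 1) * (p - c) := by
        rw [← Nat.mul_succ]; exact Nat.mul_le_mul_left (e + 1) (by omega)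
      have h4 : (k - c) * (e + 1) = (e + 1) * (k - c) := Nat.mul_comm _ _
      omega
    · have h1 : (k - c) * (e + 1) = (e + 1) * (k - p) + (e + 1) * (p - c) := by
        rw [Nat.mul_comm (k - c) (e + 1), ← Nat.mul_add]; congr 1; omega
      omega

/-- **(HIGH-END) A DROP OF EXACTLY ONE AT THE UPPER END, EVERY `k ≥ 2p − c`.** For a prime `p`, `1 ≤ c < p`, `2p ≤ k + c` and `j = (e+1)(k − p)`:
`rank_K + 1 = rank_{K₀}` at level `j` ((SYM-K) and (LOW-END) at the mirror level `(e+1)(p − c)`). -/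
theorem rank_charP_add_one_eq_rank_charZero_of_eq_high (K K₀ : Type*) [Field K] [Field K₀] (p : ℕ) [CharP K p] [CharZero K₀]
    (hp : p.Prime) (k e c j : ℕ) (hc : 0 < c) (hcp : c < p) (hk : 2 * p ≤ k + c) (hj : j = (e + 1) * (k - p)) :
    (Matrix.of fun (v : {v : Fin k → Fin (e + 2) // (∑ i, (v i : ℕ)) + j = k * (e + 1)})
        (m : {m : Fin k → Fin (e + 2) // (∑ i, (m i : ℕ)) + (j + c * (e + 1)) = k * (e + 1)}) =>
      ((((List.flatMap (colR (e + 3)))^[c] [List.ofFn (fun i => (m.1 i : ℕ))]).count (List.ofFn (fun i => (v.1 i : ℕ))) : ℕ) : K)).rank + 1 =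
    (Matrix.of fun (v : {v : Fin k → Fin (e + 2) // (∑ i, (v i : ℕ)) + j = k * (e + 1)})
        (m : {m : Fin k → Fin (e + 2) // (∑ i, (m i : ℕ)) + (j + c * (e + 1)) = k * (e + 1)}) =>
      ((((List.flatMap (colR (e + 3)))^[c] [List.ofFn (fun i => (m.1 i : ℕ))]).count (List.ofFn (fun i => (v.1 i : ℕ))) : ℕ) : K₀)).rank := by
  have h1 : (k - c) * (e + 1) = (e + 1) * (k - p) + (e + 1) * (p - c) := by
    rw [Nat.mul_comm (k - c) (e + 1), ← Nat.mul_add]; congr 1; omega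
  have hjj : j + (e + 1) * (p - c) = (k - c) * (e + 1) := by omega
  rw [rank_levels_symm_field K k e c j _ hjj, rank_levels_symm_field K₀ k e c j _ hjj]
  exact rank_charP_add_one_eq_rank_charZero_of_eq_low K K₀ p hp k e c _ hc hcp hk rfl

/-- **(WIN-OUT) THE DROP WINDOW, EVERY BAND — HEADLINE.** For a prime `p`, `c < p`, ANY `k`, `e`, a field `K` of characteristic `p` and a field
`K₀` of characteristic `0`: outside `(e+1)(p − c) ≤ j ≤ (e+1)(k − p)` anchor 229's multiplicity matrix of `×q^c` on `K[x₁,…,x_k]/(xᵢ^{e+2})`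
at level `j` (VERBATIM) has `rank_K = rank_{K₀}` — anchor 320's (LOC) without the first-band hypotheses `k + c = 2p + r`, `r < 2c`. -/
theorem rank_charP_eq_rank_charZero_of_out_of_window (K K₀ : Type*) [Field K] [Field K₀] (p : ℕ) [CharP K p] [CharZero K₀]
    (hp : p.Prime) (k e c j : ℕ) (hcp : c < p) (hj : j < (e + 1) * (p - c) ∨ (e + 1) * (k - p) < j) :
    (Matrix.of fun (v : {v : Fin k → Fin (e + 2) // (∑ i, (v i : ℕ)) + j = k * (e + 1)})
        (m : {m : Fin k → Fin (e + 2) // (∑ i, (m i : ℕ)) + (j + c * (e + 1)) = k * (e + 1)}) =>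
      ((((List.flatMap (colR (e + 3)))^[c] [List.ofFn (fun i => (m.1 i : ℕ))]).count (List.ofFn (fun i => (v.1 i : ℕ))) : ℕ) : K)).rank =
    (Matrix.of fun (v : {v : Fin k → Fin (e + 2) // (∑ i, (v i : ℕ)) + j = k * (e + 1)})
        (m : {m : Fin k → Fin (e + 2) // (∑ i, (m i : ℕ)) + (j + c * (e + 1)) = k * (e + 1)}) =>
      ((((List.flatMap (colR (e + 3)))^[c] [List.ofFn (fun i => (m.1 i : ℕ))]).count (List.ofFn (fun i => (v.1 i : ℕ))) : ℕ) : K₀)).rank := by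
  rcases hj with hj | hj
  · exact rank_charP_eq_rank_charZero_of_lt K K₀ p hp k e c j hcp hj
  · exact rank_charP_eq_rank_charZero_of_gt K K₀ p hp k e c j hcp hj

/-- **(WIN-ENDS) A DROP OF EXACTLY ONE AT BOTH ENDS OF THE WINDOW, EVERY `k ≥ 2p − c` — HEADLINE.** For a prime `p`, `1 ≤ c < p`, `2p ≤ k + c`
and `j = (e+1)(p − c)` or `j = (e+1)(k − p)`: `rank_K + 1 = rank_{K₀}` — anchor 320's (ENDS) without `r < 2c` (anchor 304's (BDRY) is the case
`k + c = 2p`, where the two ends coincide). -/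
theorem rank_charP_add_one_eq_rank_charZero_of_window_end (K K₀ : Type*) [Field K] [Field K₀] (p : ℕ) [CharP K p] [CharZero K₀]
    (hp : p.Prime) (k e c j : ℕ) (hc : 0 < c) (hcp : c < p) (hk : 2 * p ≤ k + c) (hj : j = (e + 1) * (p - c) ∨ j = (e + 1) * (k - p)) :
    (Matrix.of fun (v : {v : Fin k → Fin (e + 2) // (∑ i, (v i : ℕ)) + j = k * (e + 1)})
        (m : {m : Fin k → Fin (e + 2) // (∑ i, (m i : ℕ)) + (j + c * (e + 1)) = k * (e + 1)}) =>
      ((((List.flatMap (colR (e + 3)))^[c] [List.ofFn (fun i => (m.1 i : ℕ))]).count (List.ofFn (fun i => (v.1 i : ℕ))) : ℕ) : K)).rank + 1 =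
    (Matrix.of fun (v : {v : Fin k → Fin (e + 2) // (∑ i, (v i : ℕ)) + j = k * (e + 1)})
        (m : {m : Fin k → Fin (e + 2) // (∑ i, (m i : ℕ)) + (j + c * (e + 1)) = k * (e + 1)}) =>
      ((((List.flatMap (colR (e + 3)))^[c] [List.ofFn (fun i => (m.1 i : ℕ))]).count (List.ofFn (fun i => (v.1 i : ℕ))) : ℕ) : K₀)).rank := by
  rcases hj with hj | hj
  · exact rank_charP_add_one_eq_rank_charZero_of_eq_low K K₀ p hp k e c j hc hcp hk hj
  · exact rank_charP_add_one_eq_rank_charZero_of_eq_high K K₀ p hp k e c j hc hcp hk hj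

end Summit.HodgeConjecture.HodgeConjecture.HodgeLocus.Census.UnitColumnRankDropWindow
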